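import Summits.PneNP.PneNP.Theorems.ChebyshevTracialDesignUnconditionalRungs
import Summits.PneNP.PneNP.Theorems.ChebyshevTracialDesignDimensionOne
import HarnessLib

/-!
# Cell pnp-psdrank, route `ChebyshevTracialDesign`: the PAIR-PINNED DESIGN VALUES `A^f_M(p,q) = Σ_U W(U,M) f(U)·1[e_p ∪ e_q ⊆ U]` are
# VIRTUALLY NONPOSITIVE ENTRYWISE (`Σ_M Σ_{p,q} (A^f_M(p,q))₊ ≤ n⁴·γ`), the pair-containment statement (CG_1') holds on the SIGN-COHERENT cone
# for EVERY mask, and (CG_1') is EQUIVALENT to cube-positivity of the entrywise negative part `min(A^f_M, 0)` (crux `TracialDecayExp20`,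
# stmt-PneNP-19878)

Brick 102 (prover g19; MEMO-21 §3(c'), MEMO-22 §1). After bricks 98–101 the first r-free rung CG_1 above NTF is, up to
`e^{−(D/4)ln(n/D)+O(ln n)}`, the statement (CG_1') «`Σ_M sup_{|v|≤1} (Σ_U W(U,M) f(U)·(Σ_p v_M(p) x_p x_{π_M p})²)₊` is `e^{−aD}`-small» for
every `f : cuts → [0,1]`, i.e. a psd-order statement about the PAIR-PINNED DESIGN-VALUE MATRIX
`A^f_M(p,q) := Σ_U W(U,M) f(U)·x_p x_{π_M p} x_q x_{π_M q}` (`x_p = 1[p ∈ U]`, `π_M` the partner map). This file records what the `r = 1`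
rung (NTF for ALL rectangles, `…UnconditionalRungs.rectangleDecayExp_all_holds`, unconditional) already gives, for ANY weight `W` whose
rectangle sums are `≤ γ`:
* §1 `sum_mul_mul_le_of_rectangles` ([0,1]-WEIGHTED rectangles inherit the bound, by the rounding lemma of brick `…DimensionOne`),
  `sum_posPart_mul_le_of_rectangles` (`Σ_M (h(M)·Σ_U W(U,M) g(U))₊ ≤ γ` for fixed `g, h ∈ [0,1]`: positive parts over `M` are a rectangle);
* §2 `sum_ite_eq_partner` (re-indexing a partner `π_M p` as a free vertex `p'` weighted by `1[p' = π_M p]`), `pairPinned_eq_sum_vertex`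
  (`A^f_M(p,q) = Σ_{p',q'} 1[p' = π_M p]·1[q' = π_M q]·Σ_U W(U,M)·(f x_p x_{p'} x_q x_{q'})(U)` — a sum of `n²` FIXED-cut-function cells), and
  **`sum_posPart_pairPinned_le`**: `Σ_M Σ_{p,q} (A^f_M(p,q))₊ ≤ n⁴·γ` — the pair-pinned design values of every mask are virtually nonpositive
  ENTRYWISE, on average over `M` (their sizes are NOT small: `A¹_M = −|PM|⁻¹[κ₂J + (κ₁−κ₂)(I+Π_M)]`, brick 98);
* §3 **`sum_posPart_containment_le_of_nonneg`**: (CG_1') ON THE SIGN-COHERENT CONE — for every mask `f ∈ [0,1]` and all matching-dependent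
  test vectors `0 ≤ v_M ≤ 1`, `Σ_M (Σ_U W f (Σ_p v_M(p) x_p x_{π_M p})²)₊ ≤ n⁴·γ` (and `v ↦ −v`): the whole difficulty of (CG_1') is sign
  cancellation between DIFFERENT edges of `M`;
* §4 **`containment_sub_negPart_abs_le`** / **`sum_containment_sub_negPart_abs_le`**: for `|v_M| ≤ 1`,
  `|Σ_U W f C_v² − Σ_{p,q} v_M(p)v_M(q)·min(A^f_M(p,q),0)| ≤ Σ_{p,q}(A^f_M(p,q))₊` per `M`, `≤ n⁴γ` summed: (CG_1') is EQUIVALENT (two-sided, up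
  to `n⁴γ`) to «the entrywise-nonnegative matrix `N^f_M := −min(A^f_M,0)` of pair-pinned virtual densities satisfies `vᵀN^f_Mv ≥ −ε` on the cube
  `|v| ≤ 1` for most `M`» — a positivity property of the MAGNITUDES of the (order-`1/|PM|`) negative design values, not a smallness statement;
* §5 the design corollaries **`pairPinned_posPart_decay`**, **`containment_signCoherent_decay`**, **`containment_negPart_reduction`** (balanced
  exact designs of degree `dq n`, `Σ|w| ≤ 20`: `γ = 20·e^{−a·dq n}`, unconditional).
[cite: Rothvoss2017, §2 and Lemma 7 (PDF pp. 6–8)] [cite: KeevashLifshitz2023, Thm. 1.8] [cite: Grigoriev2001, Lemma 1.4 (PDF p. 8)]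
[cite: GriblingDelaatLaurent2019, §5]
Stature: support/instrument (kernel lane, no defs, axioms standard). WHAT THIS IS NOT: nothing on the cube-positivity of `N^f_M` for general
`f` (that IS (CG_1')), no proof or refutation of `TracialDecayExp20`, nothing on psd rank of P_PM(K_n), no P-vs-NP content. Supports stmt-PneNP-19878.
-/

set_option linter.dupNamespace false -- `Summit.PneNP.PneNP.…`: summit = sub-problem (D-0017)

noncomputable section

namespace Summit.PneNP.PneNP.Theorems.ChebyshevTracialDesignPairContainmentEntrywise

open Finset Literature.Barriers.PneNP Literature.Combinatorics.Optimization
open Summit.PneNP.PneNP.Theorems.ChebyshevTracialDesignDimensionOne (sum_box_le_rectangle)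
open Summit.PneNP.PneNP.Theorems.ChebyshevTracialDesignUnconditionalRungs (rectangleDecayExp_all_holds)

variable {n : ℕ}

/-! ### §1 Weighted rectangles and positive parts from the all-rectangle bound -/

/-- **[0,1]-weighted rectangles inherit the all-rectangle bound**: if every 0/1 rectangle has `W`-mass `≤ γ`, then
`Σ_{U,M} W(U,M) g(U) h(M) ≤ γ` for all `g, h` with values in `[0,1]` (bilinearity / greedy rounding, brick `…DimensionOne`).
[cite: Rothvoss2017, §2 and Lemma 7 (PDF pp. 6–8)] -/
theorem sum_mul_mul_le_of_rectangles (W : OddSet n → PMatch n → ℝ) {γ : ℝ}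
    (hR : ∀ (A : Finset (OddSet n)) (B : Finset (PMatch n)), ∑ U ∈ A, ∑ M ∈ B, W U M ≤ γ)
    (g : OddSet n → ℝ) (h : PMatch n → ℝ) (hg : ∀ U, 0 ≤ g U ∧ g U ≤ 1) (hh : ∀ M, 0 ≤ h M ∧ h M ≤ 1) :
    ∑ U, ∑ M, W U M * (g U * h M) ≤ γ := by
  obtain ⟨A, B, -, hle⟩ := sum_box_le_rectangle W (fun _ _ => False) g h hg hh (fun _ _ h => h.elim)
  exact hle.trans (hR A B)

/-- The all-rectangle bound is nonnegative (empty rectangle). [folklore] -/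
theorem rectBound_nonneg (W : OddSet n → PMatch n → ℝ) {γ : ℝ}
    (hR : ∀ (A : Finset (OddSet n)) (B : Finset (PMatch n)), ∑ U ∈ A, ∑ M ∈ B, W U M ≤ γ) : 0 ≤ γ := by
  simpa using hR ∅ ∅

/-- **Positive parts over the matchings are a rectangle**: for FIXED `g : cuts → [0,1]` and `h : PM → [0,1]`,
`Σ_M (h(M)·Σ_U W(U,M) g(U))₊ ≤ γ` — take the matching side `h·1[Σ_U W g > 0]`. [cite: Rothvoss2017, §2 and Lemma 7 (PDF pp. 6–8)] -/
theorem sum_posPart_mul_le_of_rectangles (W : OddSet n → PMatch n → ℝ) {γ : ℝ}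
    (hR : ∀ (A : Finset (OddSet n)) (B : Finset (PMatch n)), ∑ U ∈ A, ∑ M ∈ B, W U M ≤ γ)
    (g : OddSet n → ℝ) (hg : ∀ U, 0 ≤ g U ∧ g U ≤ 1) (h : PMatch n → ℝ) (hh : ∀ M, 0 ≤ h M ∧ h M ≤ 1) :
    ∑ M, max (h M * ∑ U, W U M * g U) 0 ≤ γ := by
  classical
  set s : PMatch n → ℝ := fun M => ∑ U, W U M * g U with hs
  set h' : PMatch n → ℝ := fun M => if 0 < s M then h M else 0 with hh'
  have hh'01 : ∀ M, 0 ≤ h' M ∧ h' M ≤ 1 := fun M => by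
    rw [hh']; dsimp only
    split_ifs
    · exact hh M
    · exact ⟨le_rfl, zero_le_one⟩
  have hkey : ∀ M, max (h M * s M) 0 = h' M * s M := fun M => by
    rw [hh']; dsimp only
    by_cases hsM : 0 < s M
    · rw [if_pos hsM, max_eq_left (mul_nonneg (hh M).1 hsM.le)]
    · rw [if_neg hsM, zero_mul, max_eq_right (mul_nonpos_of_nonneg_of_nonpos (hh M).1 (not_lt.1 hsM))]
  calc ∑ M, max (h M * s M) 0 = ∑ M, h' M * s M := sum_congr rfl fun M _ => hkey M
    _ = ∑ M, ∑ U, W U M * (g U * h' M) := by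
        refine sum_congr rfl fun M _ => ?_
        rw [hs]; dsimp only
        rw [mul_sum]
        exact sum_congr rfl fun U _ => by ring
    _ = ∑ U, ∑ M, W U M * (g U * h' M) := sum_comm
    _ ≤ γ := sum_mul_mul_le_of_rectangles W hR g h' hg hh'01

/-- `(Σ_i c_i)₊ ≤ Σ_i (c_i)₊`. [folklore] -/
theorem posPart_sum_le {ι : Type*} (s : Finset ι) (c : ι → ℝ) :
    max (∑ i ∈ s, c i) 0 ≤ ∑ i ∈ s, max (c i) 0 :=
  max_le (sum_le_sum fun _ _ => le_max_left _ _) (sum_nonneg fun _ _ => le_max_right _ _)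

/-! ### §2 Pair-pinned design values are virtually nonpositive, entrywise -/

/-- Re-indexing the partner: `Σ_{p'} 1[p' = π_M p]·g(p') = g(π_M p)`. [folklore] -/
theorem sum_ite_eq_partner (M : PMatch n) (p : Fin n) (g : Fin n → ℝ) :
    ∑ p', (if p' = M.2.partner p then g p' else 0) = g (M.2.partner p) := by
  rw [Finset.sum_ite_eq' univ (M.2.partner p) g, if_pos (mem_univ _)]

/-- **The pair-pinned design value as `n²` fixed-cut-function cells**:
`Σ_U W(U,M) f(U) x_p x_{π_M p} x_q x_{π_M q} = Σ_{p',q'} 1[p' = π_M p]·1[q' = π_M q]·Σ_U W(U,M)·f(U) x_p x_{p'} x_q x_{q'}`.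
[cite: Rothvoss2017, §2 (PDF p. 6)] -/
theorem pairPinned_eq_sum_vertex (W : OddSet n → PMatch n → ℝ) (f : OddSet n → ℝ) (M : PMatch n) (p q : Fin n) :
    ∑ U : OddSet n, W U M * (f U * (((if p ∈ U.1 then (1 : ℝ) else 0) * (if M.2.partner p ∈ U.1 then (1 : ℝ) else 0)) *
        ((if q ∈ U.1 then (1 : ℝ) else 0) * (if M.2.partner q ∈ U.1 then (1 : ℝ) else 0)))) =
      ∑ p', ∑ q', ((if p' = M.2.partner p then (1 : ℝ) else 0) * (if q' = M.2.partner q then (1 : ℝ) else 0)) *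
        ∑ U : OddSet n, W U M * (f U * (((if p ∈ U.1 then (1 : ℝ) else 0) * (if p' ∈ U.1 then (1 : ℝ) else 0)) *
          ((if q ∈ U.1 then (1 : ℝ) else 0) * (if q' ∈ U.1 then (1 : ℝ) else 0)))) := by
  set x : OddSet n → Fin n → ℝ := fun U a => if a ∈ U.1 then (1 : ℝ) else 0 with hx
  change ∑ U : OddSet n, W U M * (f U * ((x U p * x U (M.2.partner p)) * (x U q * x U (M.2.partner q)))) =
    ∑ p', ∑ q', ((if p' = M.2.partner p then (1 : ℝ) else 0) * (if q' = M.2.partner q then (1 : ℝ) else 0)) *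
      ∑ U : OddSet n, W U M * (f U * ((x U p * x U p') * (x U q * x U q')))
  -- right-hand side: push the `U`-sum out and re-index the partners
  have hrhs : ∀ U : OddSet n,
      ∑ p', ∑ q', ((if p' = M.2.partner p then (1 : ℝ) else 0) * (if q' = M.2.partner q then (1 : ℝ) else 0)) *
          (W U M * (f U * ((x U p * x U p') * (x U q * x U q')))) =
        W U M * (f U * ((x U p * x U (M.2.partner p)) * (x U q * x U (M.2.partner q)))) := by
    intro U
    have h1 : ∀ p', ∑ q', ((if p' = M.2.partner p then (1 : ℝ) else 0) * (if q' = M.2.partner q then (1 : ℝ) else 0)) *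
        (W U M * (f U * ((x U p * x U p') * (x U q * x U q')))) =
        (if p' = M.2.partner p then (1 : ℝ) else 0) * (W U M * (f U * ((x U p * x U p') * (x U q * x U (M.2.partner q))))) := by
      intro p'
      have := sum_ite_eq_partner M q (fun q' => (if p' = M.2.partner p then (1 : ℝ) else 0) *
        (W U M * (f U * ((x U p * x U p') * (x U q * x U q')))))
      rw [← this]
      refine sum_congr rfl fun q' _ => ?_
      split_ifs <;> ring
    rw [sum_congr rfl fun p' _ => h1 p']
    have := sum_ite_eq_partner M p (fun p' => W U M * (f U * ((x U p * x U p') * (x U q * x U (M.2.partner q)))))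
    rw [← this]
    refine sum_congr rfl fun p' _ => ?_
    split_ifs <;> ring
  symm
  calc ∑ p', ∑ q', ((if p' = M.2.partner p then (1 : ℝ) else 0) * (if q' = M.2.partner q then (1 : ℝ) else 0)) *
        ∑ U : OddSet n, W U M * (f U * ((x U p * x U p') * (x U q * x U q')))
      = ∑ p', ∑ q', ∑ U : OddSet n, ((if p' = M.2.partner p then (1 : ℝ) else 0) * (if q' = M.2.partner q then (1 : ℝ) else 0)) *
          (W U M * (f U * ((x U p * x U p') * (x U q * x U q')))) := by
        refine sum_congr rfl fun p' _ => sum_congr rfl fun q' _ => ?_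
        rw [mul_sum]
    _ = ∑ p', ∑ U : OddSet n, ∑ q', ((if p' = M.2.partner p then (1 : ℝ) else 0) * (if q' = M.2.partner q then (1 : ℝ) else 0)) *
          (W U M * (f U * ((x U p * x U p') * (x U q * x U q')))) := sum_congr rfl fun p' _ => sum_comm
    _ = ∑ U : OddSet n, ∑ p', ∑ q', ((if p' = M.2.partner p then (1 : ℝ) else 0) * (if q' = M.2.partner q then (1 : ℝ) else 0)) *
          (W U M * (f U * ((x U p * x U p') * (x U q * x U q')))) := sum_comm
    _ = ∑ U : OddSet n, W U M * (f U * ((x U p * x U (M.2.partner p)) * (x U q * x U (M.2.partner q)))) :=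
        sum_congr rfl fun U _ => hrhs U

/-- **PAIR-PINNED DESIGN VALUES ARE VIRTUALLY NONPOSITIVE, ENTRYWISE.** If every rectangle has `W`-mass `≤ γ`, then for every
`f : cuts → [0,1]`: `Σ_M Σ_{p,q} (Σ_U W(U,M) f(U) x_p x_{π_M p} x_q x_{π_M q})₊ ≤ n⁴·γ`.
[cite: Rothvoss2017, §2 and Lemma 7 (PDF pp. 6–8)] [cite: Grigoriev2001, Lemma 1.4 (PDF p. 8)] -/
theorem sum_posPart_pairPinned_le (W : OddSet n → PMatch n → ℝ) {γ : ℝ}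
    (hR : ∀ (A : Finset (OddSet n)) (B : Finset (PMatch n)), ∑ U ∈ A, ∑ M ∈ B, W U M ≤ γ)
    (f : OddSet n → ℝ) (hf : ∀ U, 0 ≤ f U ∧ f U ≤ 1) :
    ∑ M : PMatch n, ∑ p : Fin n, ∑ q : Fin n,
        max (∑ U : OddSet n, W U M * (f U * (((if p ∈ U.1 then (1 : ℝ) else 0) * (if M.2.partner p ∈ U.1 then (1 : ℝ) else 0)) *
          ((if q ∈ U.1 then (1 : ℝ) else 0) * (if M.2.partner q ∈ U.1 then (1 : ℝ) else 0))))) 0 ≤ (n : ℝ) ^ 4 * γ := by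
  set x : OddSet n → Fin n → ℝ := fun U a => if a ∈ U.1 then (1 : ℝ) else 0 with hx
  have hx01 : ∀ U a, 0 ≤ x U a ∧ x U a ≤ 1 := fun U a => by rw [hx]; dsimp only; split_ifs <;> norm_num
  -- the fixed cut functions `g_{p p' q q'} = f x_p x_{p'} x_q x_{q'} ∈ [0,1]` and matching indicators `h ∈ [0,1]`
  set g : Fin n → Fin n → Fin n → Fin n → OddSet n → ℝ := fun p p' q q' U => f U * ((x U p * x U p') * (x U q * x U q')) with hg
  have hg01 : ∀ p p' q q' U, 0 ≤ g p p' q q' U ∧ g p p' q q' U ≤ 1 := by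
    intro p p' q q' U
    rw [hg]; dsimp only
    have h1 := hf U; have h2 := hx01 U p; have h3 := hx01 U p'; have h4 := hx01 U q; have h5 := hx01 U q'
    exact ⟨mul_nonneg h1.1 (mul_nonneg (mul_nonneg h2.1 h3.1) (mul_nonneg h4.1 h5.1)),
      mul_le_one₀ h1.2 (mul_nonneg (mul_nonneg h2.1 h3.1) (mul_nonneg h4.1 h5.1))
        (mul_le_one₀ (mul_le_one₀ h2.2 h3.1 h3.2) (mul_nonneg h4.1 h5.1) (mul_le_one₀ h4.2 h5.1 h5.2))⟩
  set h : Fin n → Fin n → Fin n → Fin n → PMatch n → ℝ := fun p p' q q' M =>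
    (if p' = M.2.partner p then (1 : ℝ) else 0) * (if q' = M.2.partner q then (1 : ℝ) else 0) with hh
  have hh01 : ∀ p p' q q' M, 0 ≤ h p p' q q' M ∧ h p p' q q' M ≤ 1 := fun p p' q q' M => by
    rw [hh]; dsimp only; split_ifs <;> norm_num
  -- each entry is a sum of `n²` cells; positive part is subadditive
  have hentry : ∀ (M : PMatch n) (p q : Fin n),
      max (∑ U : OddSet n, W U M * (f U * ((x U p * x U (M.2.partner p)) * (x U q * x U (M.2.partner q))))) 0 ≤
        ∑ p', ∑ q', max (h p p' q q' M * ∑ U : OddSet n, W U M * g p p' q q' U) 0 := by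
    intro M p q
    have hid : ∑ U : OddSet n, W U M * (f U * ((x U p * x U (M.2.partner p)) * (x U q * x U (M.2.partner q)))) =
        ∑ p', ∑ q', ((if p' = M.2.partner p then (1 : ℝ) else 0) * (if q' = M.2.partner q then (1 : ℝ) else 0)) *
          ∑ U : OddSet n, W U M * (f U * ((x U p * x U p') * (x U q * x U q'))) := pairPinned_eq_sum_vertex W f M p q
    rw [hid]
    refine (posPart_sum_le _ _).trans (sum_le_sum fun p' _ => (posPart_sum_le _ _).trans (sum_le_sum fun q' _ => le_of_eq ?_))
    rfl
  calc ∑ M : PMatch n, ∑ p : Fin n, ∑ q : Fin n,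
        max (∑ U : OddSet n, W U M * (f U * ((x U p * x U (M.2.partner p)) * (x U q * x U (M.2.partner q))))) 0
      ≤ ∑ M : PMatch n, ∑ p : Fin n, ∑ q : Fin n, ∑ p', ∑ q', max (h p p' q q' M * ∑ U : OddSet n, W U M * g p p' q q' U) 0 :=
        sum_le_sum fun M _ => sum_le_sum fun p _ => sum_le_sum fun q _ => hentry M p q
    _ = ∑ p : Fin n, ∑ q : Fin n, ∑ p' : Fin n, ∑ q' : Fin n,
          ∑ M : PMatch n, max (h p p' q q' M * ∑ U : OddSet n, W U M * g p p' q q' U) 0 := by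
        rw [sum_comm]
        refine sum_congr rfl fun p _ => ?_
        rw [sum_comm]
        refine sum_congr rfl fun q _ => ?_
        rw [sum_comm]
        refine sum_congr rfl fun p' _ => ?_
        rw [sum_comm]
    _ ≤ ∑ p : Fin n, ∑ q : Fin n, ∑ p' : Fin n, ∑ q' : Fin n, γ :=
        sum_le_sum fun p _ => sum_le_sum fun q _ => sum_le_sum fun p' _ => sum_le_sum fun q' _ =>
          sum_posPart_mul_le_of_rectangles W hR (g p p' q q') (hg01 p p' q q') (h p p' q q') (hh01 p p' q q')
    _ = (n : ℝ) ^ 4 * γ := by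
        simp only [sum_const, card_univ, Fintype.card_fin, nsmul_eq_mul]
        ring

/-! ### §3 (CG_1') on the sign-coherent cone, for every mask -/

/-- Expanding the square of the containment form: `Σ_U W f (Σ_p v_p x_p x_{πp})² = Σ_{p,q} v_p v_q A^f_M(p,q)`. [folklore] -/
theorem containment_sq_eq_sum_pairPinned (W : OddSet n → PMatch n → ℝ) (f : OddSet n → ℝ) (M : PMatch n) (v : Fin n → ℝ) :
    ∑ U : OddSet n, W U M * (f U * (∑ p, v p * ((if p ∈ U.1 then (1 : ℝ) else 0) * (if M.2.partner p ∈ U.1 then (1 : ℝ) else 0))) ^ 2) =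
      ∑ p, ∑ q, v p * v q * ∑ U : OddSet n, W U M * (f U * (((if p ∈ U.1 then (1 : ℝ) else 0) * (if M.2.partner p ∈ U.1 then (1 : ℝ) else 0)) *
        ((if q ∈ U.1 then (1 : ℝ) else 0) * (if M.2.partner q ∈ U.1 then (1 : ℝ) else 0)))) := by
  set x : OddSet n → Fin n → ℝ := fun U a => if a ∈ U.1 then (1 : ℝ) else 0 with hx
  change ∑ U : OddSet n, W U M * (f U * (∑ p, v p * (x U p * x U (M.2.partner p))) ^ 2) =
    ∑ p, ∑ q, v p * v q * ∑ U : OddSet n, W U M * (f U * ((x U p * x U (M.2.partner p)) * (x U q * x U (M.2.partner q))))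
  have hsq : ∀ U : OddSet n, (∑ p, v p * (x U p * x U (M.2.partner p))) ^ 2 =
      ∑ p, ∑ q, v p * v q * ((x U p * x U (M.2.partner p)) * (x U q * x U (M.2.partner q))) := fun U => by
    rw [sq, sum_mul_sum]
    exact sum_congr rfl fun p _ => sum_congr rfl fun q _ => by ring
  symm
  calc ∑ p, ∑ q, v p * v q * ∑ U : OddSet n, W U M * (f U * ((x U p * x U (M.2.partner p)) * (x U q * x U (M.2.partner q))))
      = ∑ p, ∑ q, ∑ U : OddSet n, W U M * (f U * (v p * v q * ((x U p * x U (M.2.partner p)) * (x U q * x U (M.2.partner q))))) := by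
        refine sum_congr rfl fun p _ => sum_congr rfl fun q _ => ?_
        rw [mul_sum]
        exact sum_congr rfl fun U _ => by ring
    _ = ∑ p, ∑ U : OddSet n, ∑ q, W U M * (f U * (v p * v q * ((x U p * x U (M.2.partner p)) * (x U q * x U (M.2.partner q))))) :=
        sum_congr rfl fun p _ => sum_comm
    _ = ∑ U : OddSet n, ∑ p, ∑ q, W U M * (f U * (v p * v q * ((x U p * x U (M.2.partner p)) * (x U q * x U (M.2.partner q))))) :=
        sum_comm
    _ = ∑ U : OddSet n, W U M * (f U * (∑ p, v p * (x U p * x U (M.2.partner p))) ^ 2) := by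
        refine sum_congr rfl fun U _ => ?_
        rw [hsq, mul_sum, mul_sum]
        refine sum_congr rfl fun p _ => ?_
        rw [mul_sum, mul_sum]

/-- **(CG_1') ON THE SIGN-COHERENT CONE.** If every rectangle has `W`-mass `≤ γ`, then for every mask `f : cuts → [0,1]` and every family of
NONNEGATIVE matching-dependent test vectors `0 ≤ v_M(p) ≤ 1`:
`Σ_M (Σ_U W(U,M) f(U)·(Σ_p v_M(p) x_p x_{π_M p})²)₊ ≤ n⁴·γ`. (By evenness the same holds for `−1 ≤ v_M ≤ 0`.)
[cite: Rothvoss2017, §2 and Lemma 7 (PDF pp. 6–8)] [cite: Grigoriev2001, Lemma 1.4 (PDF p. 8)] [cite: GriblingDelaatLaurent2019, §5] -/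
theorem sum_posPart_containment_le_of_nonneg (W : OddSet n → PMatch n → ℝ) {γ : ℝ}
    (hR : ∀ (A : Finset (OddSet n)) (B : Finset (PMatch n)), ∑ U ∈ A, ∑ M ∈ B, W U M ≤ γ)
    (f : OddSet n → ℝ) (hf : ∀ U, 0 ≤ f U ∧ f U ≤ 1) (v : PMatch n → Fin n → ℝ) (hv : ∀ M p, 0 ≤ v M p ∧ v M p ≤ 1) :
    ∑ M : PMatch n, max (∑ U : OddSet n, W U M *
        (f U * (∑ p, v M p * ((if p ∈ U.1 then (1 : ℝ) else 0) * (if M.2.partner p ∈ U.1 then (1 : ℝ) else 0))) ^ 2)) 0 ≤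
      (n : ℝ) ^ 4 * γ := by
  set x : OddSet n → Fin n → ℝ := fun U a => if a ∈ U.1 then (1 : ℝ) else 0 with hx
  -- abbreviation for the pair-pinned design value
  set A : PMatch n → Fin n → Fin n → ℝ := fun M p q =>
    ∑ U : OddSet n, W U M * (f U * ((x U p * x U (M.2.partner p)) * (x U q * x U (M.2.partner q)))) with hA
  have hmain : ∑ M : PMatch n, ∑ p : Fin n, ∑ q : Fin n, max (A M p q) 0 ≤ (n : ℝ) ^ 4 * γ :=
    sum_posPart_pairPinned_le W hR f hf
  have hper : ∀ M : PMatch n, max (∑ U : OddSet n, W U M * (f U * (∑ p, v M p * (x U p * x U (M.2.partner p))) ^ 2)) 0 ≤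
      ∑ p, ∑ q, max (A M p q) 0 := by
    intro M
    have hid : ∑ U : OddSet n, W U M * (f U * (∑ p, v M p * (x U p * x U (M.2.partner p))) ^ 2) =
        ∑ p, ∑ q, v M p * v M q * A M p q := containment_sq_eq_sum_pairPinned W f M (v M)
    rw [hid]
    refine (posPart_sum_le _ _).trans (sum_le_sum fun p _ => (posPart_sum_le _ _).trans (sum_le_sum fun q _ => ?_))
    have hvv0 : 0 ≤ v M p * v M q := mul_nonneg (hv M p).1 (hv M q).1
    have hvv1 : v M p * v M q ≤ 1 := by nlinarith [(hv M p).1, (hv M p).2, (hv M q).1, (hv M q).2]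
    refine max_le ?_ (le_max_right _ _)
    calc v M p * v M q * A M p q ≤ v M p * v M q * max (A M p q) 0 := mul_le_mul_of_nonneg_left (le_max_left _ _) hvv0
      _ ≤ 1 * max (A M p q) 0 := mul_le_mul_of_nonneg_right hvv1 (le_max_right _ _)
      _ = max (A M p q) 0 := one_mul _
  exact (sum_le_sum fun M _ => hper M).trans hmain

/-! ### §4 (CG_1') is cube-positivity of the entrywise negative part -/

/-- **REDUCTION TO THE NEGATIVE PART, per matching.** For `|v_p| ≤ 1`:
`|Σ_U W f (Σ_p v_p x_p x_{πp})² − Σ_{p,q} v_p v_q·min(A^f_M(p,q), 0)| ≤ Σ_{p,q} (A^f_M(p,q))₊`. [folklore] -/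
theorem containment_sub_negPart_abs_le (W : OddSet n → PMatch n → ℝ) (f : OddSet n → ℝ) (M : PMatch n)
    (v : Fin n → ℝ) (hv : ∀ p, |v p| ≤ 1) :
    |∑ U : OddSet n, W U M * (f U * (∑ p, v p * ((if p ∈ U.1 then (1 : ℝ) else 0) * (if M.2.partner p ∈ U.1 then (1 : ℝ) else 0))) ^ 2) -
        ∑ p, ∑ q, v p * v q * min (∑ U : OddSet n, W U M * (f U * (((if p ∈ U.1 then (1 : ℝ) else 0) *
          (if M.2.partner p ∈ U.1 then (1 : ℝ) else 0)) * ((if q ∈ U.1 then (1 : ℝ) else 0) * (if M.2.partner q ∈ U.1 then (1 : ℝ) else 0))))) 0| ≤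
      ∑ p, ∑ q, max (∑ U : OddSet n, W U M * (f U * (((if p ∈ U.1 then (1 : ℝ) else 0) * (if M.2.partner p ∈ U.1 then (1 : ℝ) else 0)) *
        ((if q ∈ U.1 then (1 : ℝ) else 0) * (if M.2.partner q ∈ U.1 then (1 : ℝ) else 0))))) 0 := by
  set x : OddSet n → Fin n → ℝ := fun U a => if a ∈ U.1 then (1 : ℝ) else 0 with hx
  set A : Fin n → Fin n → ℝ := fun p q =>
    ∑ U : OddSet n, W U M * (f U * ((x U p * x U (M.2.partner p)) * (x U q * x U (M.2.partner q)))) with hA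
  have hid : ∑ U : OddSet n, W U M * (f U * (∑ p, v p * (x U p * x U (M.2.partner p))) ^ 2) =
      ∑ p, ∑ q, v p * v q * A p q := containment_sq_eq_sum_pairPinned W f M v
  change |∑ U : OddSet n, W U M * (f U * (∑ p, v p * (x U p * x U (M.2.partner p))) ^ 2) -
      ∑ p, ∑ q, v p * v q * min (A p q) 0| ≤ ∑ p, ∑ q, max (A p q) 0
  rw [hid]
  have hsplit : ∑ p, ∑ q, v p * v q * A p q - ∑ p, ∑ q, v p * v q * min (A p q) 0 = ∑ p, ∑ q, v p * v q * max (A p q) 0 := by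
    rw [← sum_sub_distrib]
    refine sum_congr rfl fun p _ => ?_
    rw [← sum_sub_distrib]
    refine sum_congr rfl fun q _ => ?_
    have : A p q = min (A p q) 0 + max (A p q) 0 := by rw [min_add_max, add_zero]
    linear_combination (v p * v q) * this
  rw [hsplit]
  refine (abs_sum_le_sum_abs _ _).trans (sum_le_sum fun p _ => (abs_sum_le_sum_abs _ _).trans (sum_le_sum fun q _ => ?_))
  rw [abs_mul, abs_of_nonneg (le_max_right (A p q) 0)]
  have hvv : |v p * v q| ≤ 1 := by rw [abs_mul]; exact mul_le_one₀ (hv p) (abs_nonneg _) (hv q)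
  calc |v p * v q| * max (A p q) 0 ≤ 1 * max (A p q) 0 := mul_le_mul_of_nonneg_right hvv (le_max_right _ _)
    _ = max (A p q) 0 := one_mul _

/-- **(CG_1') IS CUBE-POSITIVITY OF THE NEGATIVE PART (two-sided, summed).** If every rectangle has `W`-mass `≤ γ`, then for every mask
`f : cuts → [0,1]` and every family `|v_M(p)| ≤ 1`:
`Σ_M |Σ_U W f C_{v_M}² − Σ_{p,q} v_M(p)v_M(q)·min(A^f_M(p,q),0)| ≤ n⁴·γ`. [cite: Rothvoss2017, §2 and Lemma 7 (PDF pp. 6–8)]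
[cite: Grigoriev2001, Lemma 1.4 (PDF p. 8)] [cite: GriblingDelaatLaurent2019, §5] -/
theorem sum_containment_sub_negPart_abs_le (W : OddSet n → PMatch n → ℝ) {γ : ℝ}
    (hR : ∀ (A : Finset (OddSet n)) (B : Finset (PMatch n)), ∑ U ∈ A, ∑ M ∈ B, W U M ≤ γ)
    (f : OddSet n → ℝ) (hf : ∀ U, 0 ≤ f U ∧ f U ≤ 1) (v : PMatch n → Fin n → ℝ) (hv : ∀ M p, |v M p| ≤ 1) :
    ∑ M : PMatch n, |∑ U : OddSet n, W U M *
          (f U * (∑ p, v M p * ((if p ∈ U.1 then (1 : ℝ) else 0) * (if M.2.partner p ∈ U.1 then (1 : ℝ) else 0))) ^ 2) -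
        ∑ p, ∑ q, v M p * v M q * min (∑ U : OddSet n, W U M * (f U * (((if p ∈ U.1 then (1 : ℝ) else 0) *
          (if M.2.partner p ∈ U.1 then (1 : ℝ) else 0)) * ((if q ∈ U.1 then (1 : ℝ) else 0) * (if M.2.partner q ∈ U.1 then (1 : ℝ) else 0))))) 0| ≤
      (n : ℝ) ^ 4 * γ :=
  (sum_le_sum fun M _ => containment_sub_negPart_abs_le W f M (v M) (hv M)).trans (sum_posPart_pairPinned_le W hR f hf)

/-- Positive parts are 1-Lipschitz: `(a)₊ ≤ (b)₊ + |a − b|`. [folklore] -/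
theorem posPart_le_posPart_add_abs (a b : ℝ) : max a 0 ≤ max b 0 + |a - b| := by
  refine max_le ?_ (add_nonneg (le_max_right _ _) (abs_nonneg _))
  have := le_abs_self (a - b)
  linarith [le_max_left b 0]

/-- **(CG_1') FROM cube-positivity of the negative part** (and conversely, by symmetry of `posPart_le_posPart_add_abs`):
`Σ_M (Σ_U W f C_{v_M}²)₊ ≤ Σ_M (Σ_{p,q} v_M(p)v_M(q)·min(A^f_M(p,q),0))₊ + n⁴·γ`. [cite: Rothvoss2017, §2 and Lemma 7 (PDF pp. 6–8)]
[cite: Grigoriev2001, Lemma 1.4 (PDF p. 8)] -/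
theorem sum_posPart_containment_le_negPart (W : OddSet n → PMatch n → ℝ) {γ : ℝ}
    (hR : ∀ (A : Finset (OddSet n)) (B : Finset (PMatch n)), ∑ U ∈ A, ∑ M ∈ B, W U M ≤ γ)
    (f : OddSet n → ℝ) (hf : ∀ U, 0 ≤ f U ∧ f U ≤ 1) (v : PMatch n → Fin n → ℝ) (hv : ∀ M p, |v M p| ≤ 1) :
    ∑ M : PMatch n, max (∑ U : OddSet n, W U M *
        (f U * (∑ p, v M p * ((if p ∈ U.1 then (1 : ℝ) else 0) * (if M.2.partner p ∈ U.1 then (1 : ℝ) else 0))) ^ 2)) 0 ≤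
      ∑ M : PMatch n, max (∑ p, ∑ q, v M p * v M q * min (∑ U : OddSet n, W U M * (f U * (((if p ∈ U.1 then (1 : ℝ) else 0) *
          (if M.2.partner p ∈ U.1 then (1 : ℝ) else 0)) * ((if q ∈ U.1 then (1 : ℝ) else 0) * (if M.2.partner q ∈ U.1 then (1 : ℝ) else 0))))) 0) 0 +
        (n : ℝ) ^ 4 * γ := by
  set x : OddSet n → Fin n → ℝ := fun U a => if a ∈ U.1 then (1 : ℝ) else 0 with hx
  set Q : PMatch n → ℝ := fun M => ∑ U : OddSet n, W U M * (f U * (∑ p, v M p * (x U p * x U (M.2.partner p))) ^ 2) with hQ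
  set N : PMatch n → ℝ := fun M => ∑ p, ∑ q, v M p * v M q *
    min (∑ U : OddSet n, W U M * (f U * ((x U p * x U (M.2.partner p)) * (x U q * x U (M.2.partner q))))) 0 with hN
  have h : ∑ M : PMatch n, |Q M - N M| ≤ (n : ℝ) ^ 4 * γ := sum_containment_sub_negPart_abs_le W hR f hf v hv
  change ∑ M : PMatch n, max (Q M) 0 ≤ ∑ M : PMatch n, max (N M) 0 + (n : ℝ) ^ 4 * γ
  calc ∑ M : PMatch n, max (Q M) 0 ≤ ∑ M : PMatch n, (max (N M) 0 + |Q M - N M|) :=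
        sum_le_sum fun M _ => posPart_le_posPart_add_abs (Q M) (N M)
    _ = ∑ M : PMatch n, max (N M) 0 + ∑ M : PMatch n, |Q M - N M| := sum_add_distrib
    _ ≤ ∑ M : PMatch n, max (N M) 0 + (n : ℝ) ^ 4 * γ := add_le_add le_rfl h

/-! ### §5 The design corollaries (unconditional, via the `r = 1` rung for all rectangles) -/

/-- **Pair-pinned design values of balanced Chebyshev designs are virtually nonpositive entrywise — UNCONDITIONAL.** For some `a > 0` and all
large even `n`: every balanced exact design `(t, C, w)` of degree `dq n` on levels `≤ Tq n` with `Σ|w_c| ≤ 20` and every mask `f : cuts → [0,1]`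
satisfy `Σ_M Σ_{p,q} (Σ_U W(U,M) f(U) x_p x_{π_M p} x_q x_{π_M q})₊ ≤ 20·n⁴·exp(−a·dq n)`.
[cite: Rothvoss2017, §2 and Lemma 7 (PDF pp. 6–8)] [cite: KeevashLifshitz2023, Thm. 1.8] [cite: Grigoriev2001, Lemma 1.4 (PDF p. 8)] -/
theorem pairPinned_posPart_decay :
    ∃ a : ℝ, 0 < a ∧ ∃ n₁ : ℕ, ∀ n : ℕ, n₁ ≤ n → Even n → ∀ (t : ℕ) (C : Finset ℕ) (w : ℕ → ℝ),
      IsBalancedDesign n t (Tq n) (dq n) 20 C w → ∀ f : OddSet n → ℝ, (∀ U, 0 ≤ f U ∧ f U ≤ 1) →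
        ∑ M : PMatch n, ∑ p : Fin n, ∑ q : Fin n,
          max (∑ U : OddSet n, levelWeight n t C w U M * (f U * (((if p ∈ U.1 then (1 : ℝ) else 0) *
            (if M.2.partner p ∈ U.1 then (1 : ℝ) else 0)) * ((if q ∈ U.1 then (1 : ℝ) else 0) * (if M.2.partner q ∈ U.1 then (1 : ℝ) else 0))))) 0 ≤
          (n : ℝ) ^ 4 * (20 * Real.exp (-(a * (dq n : ℝ)))) := by
  obtain ⟨a, ha, n₁, h⟩ := rectangleDecayExp_all_holds
  exact ⟨a, ha, n₁, fun n hn hev t C w hdes f hf => sum_posPart_pairPinned_le _ (h n hn hev t C w hdes) f hf⟩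

/-- **(CG_1') on the sign-coherent cone for balanced Chebyshev designs — UNCONDITIONAL.** For some `a > 0` and all large even `n`: every balanced
exact design `(t, C, w)` of degree `dq n`, `Σ|w_c| ≤ 20`, every mask `f : cuts → [0,1]` and every family of nonnegative test vectors
`0 ≤ v_M ≤ 1` satisfy `Σ_M (Σ_U W(U,M) f(U)·(Σ_p v_M(p) x_p x_{π_M p})²)₊ ≤ 20·n⁴·exp(−a·dq n)`.
[cite: Rothvoss2017, §2 and Lemma 7 (PDF pp. 6–8)] [cite: KeevashLifshitz2023, Thm. 1.8] [cite: GriblingDelaatLaurent2019, §5] -/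
theorem containment_signCoherent_decay :
    ∃ a : ℝ, 0 < a ∧ ∃ n₁ : ℕ, ∀ n : ℕ, n₁ ≤ n → Even n → ∀ (t : ℕ) (C : Finset ℕ) (w : ℕ → ℝ),
      IsBalancedDesign n t (Tq n) (dq n) 20 C w → ∀ f : OddSet n → ℝ, (∀ U, 0 ≤ f U ∧ f U ≤ 1) →
        ∀ v : PMatch n → Fin n → ℝ, (∀ M p, 0 ≤ v M p ∧ v M p ≤ 1) →
          ∑ M : PMatch n, max (∑ U : OddSet n, levelWeight n t C w U M *
            (f U * (∑ p, v M p * ((if p ∈ U.1 then (1 : ℝ) else 0) * (if M.2.partner p ∈ U.1 then (1 : ℝ) else 0))) ^ 2)) 0 ≤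
          (n : ℝ) ^ 4 * (20 * Real.exp (-(a * (dq n : ℝ)))) := by
  obtain ⟨a, ha, n₁, h⟩ := rectangleDecayExp_all_holds
  exact ⟨a, ha, n₁, fun n hn hev t C w hdes f hf v hv => sum_posPart_containment_le_of_nonneg _ (h n hn hev t C w hdes) f hf v hv⟩

/-- **(CG_1') ⟺ cube-positivity of the negative part, for balanced Chebyshev designs — UNCONDITIONAL.** For some `a > 0` and all large even
`n`: every balanced exact design `(t, C, w)` of degree `dq n`, `Σ|w_c| ≤ 20`, every mask `f : cuts → [0,1]` and every family `|v_M| ≤ 1`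
satisfy `Σ_M |Σ_U W f C_{v_M}² − Σ_{p,q} v_M(p)v_M(q)·min(A^f_M(p,q),0)| ≤ 20·n⁴·exp(−a·dq n)`.
[cite: Rothvoss2017, §2 and Lemma 7 (PDF pp. 6–8)] [cite: KeevashLifshitz2023, Thm. 1.8] [cite: GriblingDelaatLaurent2019, §5] -/
theorem containment_negPart_reduction :
    ∃ a : ℝ, 0 < a ∧ ∃ n₁ : ℕ, ∀ n : ℕ, n₁ ≤ n → Even n → ∀ (t : ℕ) (C : Finset ℕ) (w : ℕ → ℝ),
      IsBalancedDesign n t (Tq n) (dq n) 20 C w → ∀ f : OddSet n → ℝ, (∀ U, 0 ≤ f U ∧ f U ≤ 1) →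
        ∀ v : PMatch n → Fin n → ℝ, (∀ M p, |v M p| ≤ 1) →
          ∑ M : PMatch n, |∑ U : OddSet n, levelWeight n t C w U M *
              (f U * (∑ p, v M p * ((if p ∈ U.1 then (1 : ℝ) else 0) * (if M.2.partner p ∈ U.1 then (1 : ℝ) else 0))) ^ 2) -
            ∑ p, ∑ q, v M p * v M q * min (∑ U : OddSet n, levelWeight n t C w U M * (f U * (((if p ∈ U.1 then (1 : ℝ) else 0) *
              (if M.2.partner p ∈ U.1 then (1 : ℝ) else 0)) * ((if q ∈ U.1 then (1 : ℝ) else 0) * (if M.2.partner q ∈ U.1 then (1 : ℝ) else 0))))) 0| ≤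
          (n : ℝ) ^ 4 * (20 * Real.exp (-(a * (dq n : ℝ)))) := by
  obtain ⟨a, ha, n₁, h⟩ := rectangleDecayExp_all_holds
  exact ⟨a, ha, n₁, fun n hn hev t C w hdes f hf v hv => sum_containment_sub_negPart_abs_le _ (h n hn hev t C w hdes) f hf v hv⟩

end Summit.PneNP.PneNP.Theorems.ChebyshevTracialDesignPairContainmentEntrywise
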